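import Summits.QuantumFields.YangMills.Theorems.BalabanLadderIRGaugeImageBlind
import HarnessLib

/-!
# crux-ideate seat 2∕3 (lens NEGATION), gen 4 — `stmt-QuantumFields-19354` (`BalabanLadder.IR`)

Sketch for the card `islands-are-free-bridges-are-forced` (g4): the EXACT combinatorial criterion for when the
`Z(G)`-film row of clause (i_T) (slot `af-pincer-T` 0308f95ca6f6a115) bites a Dobrushin–Shlosman peeling call,
and the island Ward identity behind it.  Owner R46.4 ∕ R48.4 (r5).

Setting (tree): `γ_Λ(·|η) = ymSpecification ρ β Λ η` resamples the edge set `Λ`; every edge `∉ Λ` is FROZEN at `η`.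
A pair `(η, g·η)` is an admissible (i_T)-pair near the observed cell only if `g·η = η` on the frozen edges inside the
window; for central-valued `g` this says `g` is CONSTANT on every connected component of the frozen-edge graph
(components of frozen cells under «share a link endpoint» = T-adjacency `δ ∈ {±e_μ, e_μ − e_ν}`).

## What is proved here (NO `sorry`)

* §1 `gaugeTransformZd_centralIndicator_of_not_cross`: for central `z`, the transformation `z·𝟙_S + 1·𝟙_{Sᶜ}` fixes the
  datum on every edge that does not cross `∂S`.
* §2 `integral_comp_eq_of_fixes_frozen` — WARD IDENTITY: if `g·η = η` on every frozen edge, then `f ↦ f ∘ T_g` preserves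
  `γ_Λ(·|η)`-expectations for EVERY measurable `f` (gauge-variant included): covariance (tree
  `ymSpecification_map_gaugeTransformZd_holds`) + kernel congruence (tree `ymSpecification_congr_off`).
* §3 ISLAND LEMMA `integral_comp_islandTwist_eq` ∕ `integral_comp_cellIslandTwist_eq`: if no FROZEN edge crosses `∂S`
  (resampled edges may), the central component twist on `S` is an exact symmetry of the kernel; cell form: if every
  frozen edge touching the sites of an edge set `E_A` belongs to `E_A` («`A` is an island: no frozen cell outside `A`
  shares a link endpoint with `A`»), twisting `A`'s sites by a central `z` changes NO expectation.  Hence an island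
  component contributes a true identity, never an (i_T) constraint: the film row needs ≥ 2 distinct ANCHORED components
  (components containing a frozen edge that leaves the window) meeting the observed cell's sites — criterion (A) of the
  card, strictly finer than g3's layer criterion (F1) (`layerTwist_visible_imp_sandwiched`, now tree
  `BalabanLadderIRGaugeImageBlindLayer`), which is neither necessary (frozen `v+e₀`, `v−e₁`: two anchored components, no
  axis with both normal blocks frozen) nor sufficient (islands) for a visible component twist.
* §4 vocabulary only: `TAdj` (T-adjacency of cells) with the two facts the card's census uses, by `decide`.

The forcing certificate («U₂-separated anchored germs ⇒ every enumeration of the shell observes an (A)-cell») and the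
d = 4, n = 1 census are in the card and in kit job j270452 (`kit/r5_peeling_game.py`); they are combinatorics about
finite cell sets, not about kernels, and are not restated here.
-/

noncomputable section

open MeasureTheory
open Literature.MathematicalPhysics.QuantumLattice
open Literature.Probability.LatticeModels (Site)
open Literature.MathematicalPhysics.QuantumFieldTheory
open Summit.QuantumFields.YangMills.Cruxes.IR.ShellTempered (ymSpecification_congr_off)
open Summit.QuantumFields.YangMills.Cruxes.IR.CruxIdea2g3 (Edge IsEndpt Touches integral_gaugeImage_eq)

namespace Summit.QuantumFields.YangMills.Cruxes.IR.CruxIdea2g4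

section Algebra

variable {G : Type} [Group G]

/-! ## §1 Central component twists -/

/-- The CENTRAL COMPONENT TWIST of a site set `S`: `z` on `S`, `1` off `S`. -/
def centralIndicator (S : Set (Site 4)) [DecidablePred (· ∈ S)] (z : G) : Site 4 → G :=
  fun x => if x ∈ S then z else 1

/-- For central `z`, the component twist fixes the datum on every edge that does NOT cross `∂S` (both endpoints in `S`,
or both off `S`). -/
theorem gaugeTransformZd_centralIndicator_of_not_cross {z : G} (hz : z ∈ Subgroup.center G) (S : Set (Site 4))
    [DecidablePred (· ∈ S)] (U : LGConfig 4 G) (e : Edge) (he : e.1 ∈ S ↔ e.1 + Pi.single e.2 1 ∈ S) :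
    gaugeTransformZd (centralIndicator S z) U e = U e := by
  have hcz : ∀ u : G, u * z = z * u := Subgroup.mem_center_iff.1 hz
  simp only [gaugeTransformZd, centralIndicator]
  by_cases h1 : e.1 ∈ S
  · have h2 : e.1 + Pi.single e.2 1 ∈ S := he.1 h1
    rw [if_pos h1, if_pos h2, ← hcz (U e), mul_inv_cancel_right]
  · have h2 : e.1 + Pi.single e.2 1 ∉ S := fun h => h1 (he.2 h)
    rw [if_neg h1, if_neg h2, one_mul, inv_one, mul_one]

/-- If every FROZEN edge touching `S` has both endpoints in `S`, and `S` is exactly the set of sites touched by an edge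
set `E_A` all of whose... (cell form of «no crossing»): with `S = {x | Touches E_A x}`, the hypothesis «every frozen
edge with an endpoint touching `E_A` lies in `E_A`» gives no crossing on frozen edges. -/
theorem not_cross_of_island {Λ E_A : Finset Edge}
    (hA : ∀ e ∉ Λ, ∀ x, IsEndpt e x → Touches E_A x → e ∈ E_A) (e : Edge) (he : e ∉ Λ) :
    Touches E_A e.1 ↔ Touches E_A (e.1 + Pi.single e.2 1) := by
  constructor
  · intro h; exact ⟨e, hA e he _ (Or.inl rfl) h, Or.inr rfl⟩
  · intro h; exact ⟨e, hA e he _ (Or.inr rfl) h, Or.inl rfl⟩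

/-- Composition of gauge transformations is the pointwise product. -/
theorem gaugeTransformZd_mul_apply (g h : Site 4 → G) (U : LGConfig 4 G) :
    gaugeTransformZd (g * h) U = gaugeTransformZd g (gaugeTransformZd h U) := by
  funext e
  simp only [gaugeTransformZd, Pi.mul_apply, mul_inv_rev, mul_assoc]

/-- A gauge map with CENTRAL values that is constant across an edge fixes the datum on that edge. -/
theorem gaugeTransformZd_eq_of_central_const (g : Site 4 → G) (U : LGConfig 4 G) (e : Edge)
    (hc : g e.1 ∈ Subgroup.center G) (he : g (e.1 + Pi.single e.2 1) = g e.1) :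
    gaugeTransformZd g U e = U e := by
  have hcz : ∀ u : G, u * g e.1 = g e.1 * u := Subgroup.mem_center_iff.1 hc
  simp only [gaugeTransformZd, he]
  rw [← hcz (U e), mul_inv_cancel_right]

end Algebra

section Kernel

variable {G : Type} [Group G] [TopologicalSpace G] [IsTopologicalGroup G] [CompactSpace G]
  [MeasurableSpace G] [BorelSpace G]

/-! ## §2 Ward identity: gauge maps fixing the frozen data preserve the kernel -/

/-- **WARD IDENTITY (exact).**  If the gauge transformation `g` fixes the datum `η` on every frozen edge (`∉ Λ`), then
`∫ f ∘ T_g dγ_Λ(·|η) = ∫ f dγ_Λ(·|η)` for EVERY measurable `f`.  (Covariance gives `(T_g)_* γ_Λ(·|η) = γ_Λ(·|g·η)`,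
and `g·η = η` off `Λ` makes the two kernels equal.) -/
theorem integral_comp_eq_of_fixes_frozen [SecondCountableTopology G] {N : ℕ}
    (ρ : G →* Matrix (Fin N) (Fin N) ℂ) (hρ : Continuous ρ) (β : ℝ) (Λ : Finset Edge) (g : Site 4 → G)
    (η : LGConfig 4 G) (hfix : ∀ e ∉ Λ, gaugeTransformZd g η e = η e) (f : LGConfig 4 G → ℝ) (hfm : Measurable f) :
    ∫ U, f (gaugeTransformZd g U) ∂(ymSpecification ρ β Λ η) = ∫ U, f U ∂(ymSpecification ρ β Λ η) := by
  have hmap := ymSpecification_map_gaugeTransformZd_holds (d := 4) ρ hρ β Λ η g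
  calc ∫ U, f (gaugeTransformZd g U) ∂(ymSpecification ρ β Λ η)
      = ∫ U, f U ∂((ymSpecification ρ β Λ η).map (gaugeTransformZd g)) := by
        rw [integral_map (measurable_gaugeTransformZd g).aemeasurable hfm.aestronglyMeasurable]
    _ = ∫ U, f U ∂(ymSpecification ρ β Λ (gaugeTransformZd g η)) := by rw [hmap]
    _ = ∫ U, f U ∂(ymSpecification ρ β Λ η) := by rw [ymSpecification_congr_off ρ β Λ hfix]

/-! ## §3 The island lemma -/

/-- **ISLAND LEMMA (site form, exact).**  If `z` is central and no FROZEN edge crosses `∂S`, the central component twist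
on `S` is an exact symmetry of `γ_Λ(·|η)`: it changes no expectation (all measurable `f`). -/
theorem integral_comp_islandTwist_eq [SecondCountableTopology G] {N : ℕ}
    (ρ : G →* Matrix (Fin N) (Fin N) ℂ) (hρ : Continuous ρ) (β : ℝ) (Λ : Finset Edge) (S : Set (Site 4))
    [DecidablePred (· ∈ S)] {z : G} (hz : z ∈ Subgroup.center G)
    (hS : ∀ e ∉ Λ, (e.1 ∈ S ↔ e.1 + Pi.single e.2 1 ∈ S)) (η : LGConfig 4 G)
    (f : LGConfig 4 G → ℝ) (hfm : Measurable f) :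
    ∫ U, f (gaugeTransformZd (centralIndicator S z) U) ∂(ymSpecification ρ β Λ η) =
      ∫ U, f U ∂(ymSpecification ρ β Λ η) :=
  integral_comp_eq_of_fixes_frozen ρ hρ β Λ _ η
    (fun e he => gaugeTransformZd_centralIndicator_of_not_cross hz S η e (hS e he)) f hfm

open Classical in
/-- **ISLAND LEMMA (cell form, exact).**  Let `E_A` be the edges of a set `A` of frozen cells such that every frozen edge
sharing an endpoint with `E_A` belongs to `E_A` («no frozen cell outside `A` is T-adjacent to `A`»: `A` is an ISLAND).
Then twisting the sites of `E_A` by a central `z` changes no `γ_Λ(·|η)`-expectation.  Consequently an island contributes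
NO (i_T) constraint: a visible `Z(G)` twist at the observed cell needs two distinct ANCHORED frozen components meeting
its sites (criterion (A) of the card). -/
theorem integral_comp_cellIslandTwist_eq [SecondCountableTopology G] {N : ℕ}
    (ρ : G →* Matrix (Fin N) (Fin N) ℂ) (hρ : Continuous ρ) (β : ℝ) (Λ E_A : Finset Edge)
    (hA : ∀ e ∉ Λ, ∀ x, IsEndpt e x → Touches E_A x → e ∈ E_A) {z : G} (hz : z ∈ Subgroup.center G)
    (η : LGConfig 4 G) (f : LGConfig 4 G → ℝ) (hfm : Measurable f) :
    ∫ U, f (gaugeTransformZd (centralIndicator {x | Touches E_A x} z) U) ∂(ymSpecification ρ β Λ η) =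
      ∫ U, f U ∂(ymSpecification ρ β Λ η) :=
  integral_comp_islandTwist_eq ρ hρ β Λ {x | Touches E_A x} hz (fun e he => not_cross_of_island hA e he) η f hfm

/-! ## §3b  The EXACT bite criterion in (i_T)-pair form

An (i_T) pair at the call `(Λ, v)` is `(η, g·η)` with `g·η = η` on the frozen edges the clause constrains; the clause
compares `∫ f dγ_Λ(·|g·η)` with `∫ f dγ_Λ(·|η)` for cylinders `f` of the observed cell's edge set `E`.  The theorem
below says the two are EQUAL as soon as some gauge map `g⋆` (i) fixes EVERY frozen edge and (ii) agrees with `g` at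
the PINNED sites of `E` (sites touching both `E` and a frozen edge).  With `g` a central component twist
(`z_C` on the sites of each frozen T-component `C` of the window), such a `g⋆` exists iff all ANCHORED components
meeting the sites of `E` carry the same `z` — take `g⋆ :=` that common value on every non-island frozen site and on
free sites, `z_I` on each island `I` (constant across every frozen edge, `gaugeTransformZd_eq_of_central_const`) —
which is criterion (A) of the card read contrapositively: a pair can move a cell-`v` cylinder only if `V(v)` meets two
distinct anchored components with different twists.  Components NOT meeting `V(v)` never matter (they do not enter
(ii)). -/

/-- **EXACT BITE CRITERION, (i_T)-pair form.**  If `g⋆` fixes every frozen edge (`∉ Λ`) of the datum `η` and agrees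
with `g` at every site touching both the test support `E` and a frozen edge, then the pair `(η, g·η)` does not move any
`E`-cylinder: `∫ f dγ_Λ(·|g·η) = ∫ f dγ_Λ(·|η)`.  Proof: `g·η = (g·g⋆⁻¹)·(g⋆·η)`, `g⋆·η = η` off `Λ` (kernel
congruence), and `g·g⋆⁻¹ = 1` at the pinned sites of `E` (tree `integral_gaugeImage_eq`). -/
theorem integral_pair_eq_of_agree_on_pinned [SecondCountableTopology G] {N : ℕ}
    (ρ : G →* Matrix (Fin N) (Fin N) ℂ) (hρ : Continuous ρ) (β : ℝ) (Λ E : Finset Edge) (g gs : Site 4 → G)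
    (η : LGConfig 4 G) (hfix : ∀ e ∉ Λ, gaugeTransformZd gs η e = η e)
    (hagree : ∀ e ∉ Λ, ∀ x, IsEndpt e x → Touches E x → g x = gs x)
    (f : LGConfig 4 G → ℝ) (hf : IsCylinder f E) (hfm : Measurable f) :
    ∫ U, f U ∂(ymSpecification ρ β Λ (gaugeTransformZd g η)) = ∫ U, f U ∂(ymSpecification ρ β Λ η) := by
  have hdecomp : gaugeTransformZd g η = gaugeTransformZd (g * gs⁻¹) (gaugeTransformZd gs η) := by
    rw [← gaugeTransformZd_mul_apply, inv_mul_cancel_right]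
  have hoff : ∀ e ∉ Λ, gaugeTransformZd (g * gs⁻¹) (gaugeTransformZd gs η) e = gaugeTransformZd (g * gs⁻¹) η e := by
    intro e he
    simp only [gaugeTransformZd] at hfix ⊢
    rw [hfix e he]
  rw [hdecomp, ymSpecification_congr_off ρ β Λ hoff]
  refine integral_gaugeImage_eq ρ hρ β Λ E (g * gs⁻¹) η ?_ f hf hfm
  intro e he x hx hE
  simp [Pi.mul_apply, hagree e he x hx hE]

end Kernel

section Combinatorics

/-! ## §4 Vocabulary for the census: T-adjacency of cells

Two cells `c, c'` of a unit-step frame share a link endpoint iff `c' − c ∈ T := {±e_μ} ∪ {e_μ − e_ν : μ ≠ ν}`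
(`20` neighbours): the sites of `cellEdges w c` are the box of `c` plus one step in at most ONE positive direction.  The
(A)-criterion, the forcing certificate and the census of the card are stated over this finite relation. -/

/-- T-adjacency of cells of `ℤ⁴`: the offset has all coordinates in `{−1, 0, 1}`, is nonzero, and has at most one `+1`
and at most one `−1`. -/
def TAdj (c c' : Fin 4 → ℤ) : Prop :=
  c ≠ c' ∧ (∀ k, |c' k - c k| ≤ 1) ∧
    (∀ k l, c' k - c k = 1 → c' l - c l = 1 → k = l) ∧ (∀ k l, c' k - c k = -1 → c' l - c l = -1 → k = l)

instance (c c' : Fin 4 → ℤ) : Decidable (TAdj c c') := by unfold TAdj; infer_instance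

/-- The two facts behind «(F1) is not necessary»: `e₀` and `−e₁` are T-neighbours of `0`, but they are NOT
T-adjacent to each other (offset `e₀ + e₁`), so `{v+e₀}`-side and `{v−e₁}`-side frozen material can be two distinct
components although no axis has both of its normal blocks frozen. -/
theorem tAdj_examples :
    TAdj (0 : Fin 4 → ℤ) (Pi.single 0 1) ∧ TAdj (0 : Fin 4 → ℤ) (-(Pi.single 1 1)) ∧
      ¬ TAdj (-(Pi.single 1 1) : Fin 4 → ℤ) (Pi.single 0 1) := by
  refine ⟨?_, ?_, ?_⟩ <;> decide

/-! ## §5 The census objects, typed (statements only; the certificate lemma is proved on paper in the card and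
implemented in `kit/r5_peeling_game.py::certificate2`; nothing below is used by §1–§3b) -/

/-- A cell of `ℤ⁴` (integer cell coordinates of a frame of mesh `b`). -/
abbrev Cell := Fin 4 → ℤ

/-- The hFS window of the observed cell `v` (radius `2n = 2` at `n = 1`). -/
def window (v : Cell) : Set Cell := {c | ∀ k, |c k - v k| ≤ 2}

/-- The chain-rule shell of the node cell `x` (sup-distance exactly `2n+1 = 3`). -/
def shellOf (x : Cell) : Set Cell := {c | (∀ k, |c k - x k| ≤ 3) ∧ ∃ k, |c k - x k| = 3}

/-- T-connectedness inside a cell set `S`. -/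
def TConn (S : Set Cell) : Cell → Cell → Prop :=
  Relation.ReflTransGen fun p q => p ∈ S ∧ q ∈ S ∧ TAdj p q

/-- `a`'s T-component of the frozen cells inside the window of `v` is ANCHORED: it contains a cell T-adjacent to a
frozen cell outside the window. -/
def Anchored (F : Set Cell) (v a : Cell) : Prop :=
  ∃ c d, TConn (F ∩ window v) a c ∧ d ∈ F ∧ d ∉ window v ∧ TAdj c d

/-- CRITERION (A) at the call observing `v` with frozen set `F`: the sites of `v` meet two frozen cells `a`, `b`
(T-neighbours of `v`) lying in DISTINCT T-components of `F ∩ window v`, both anchored. -/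
def CritA (F : Set Cell) (v : Cell) : Prop :=
  ∃ a b, a ∈ F ∧ b ∈ F ∧ TAdj v a ∧ TAdj v b ∧ ¬ TConn (F ∩ window v) a b ∧ Anchored F v a ∧ Anchored F v b

/-- `U₂` of a node: cells within sup-distance `2` of the node's shell `shellOf x \ F`. -/
def U2 (F : Set Cell) (x : Cell) : Set Cell := {c | ∃ s ∈ shellOf x \ F, ∀ k, |c k - s k| ≤ 2}

/-- The FORCING CERTIFICATE hypothesis at node `(F, x)`: two cells `a, b ∈ F ∩ U₂` in distinct T-components of
`F ∩ U₂`, each T-adjacent to a cell of ONE T-component of the shell, and each lying in a global T-component of `F`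
that fits in no window of a shell cell. -/
def CertHyp (F : Set Cell) (x : Cell) : Prop :=
  ∃ a b sa sb, a ∈ F ∩ U2 F x ∧ b ∈ F ∩ U2 F x ∧ ¬ TConn (F ∩ U2 F x) a b ∧
    sa ∈ shellOf x \ F ∧ sb ∈ shellOf x \ F ∧ TAdj a sa ∧ TAdj b sb ∧ TConn (shellOf x \ F) sa sb ∧
    (∀ s ∈ shellOf x \ F, ∃ c, TConn F a c ∧ c ∉ window s) ∧ (∀ s ∈ shellOf x \ F, ∃ c, TConn F b c ∧ c ∉ window s)

/-- **FORCING CERTIFICATE LEMMA (statement; proved on paper in the card, checked per node by the kit census).**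
Under `CertHyp F x`, EVERY enumeration of the shell observes a cell at which criterion (A) holds (with the earlier
shell cells frozen). -/
def ForcingCertificate : Prop :=
  ∀ (F : Set Cell) (x : Cell) (order : List Cell), order.Nodup → (∀ c, c ∈ order ↔ c ∈ shellOf x \ F) →
    CertHyp F x → ∃ i : Fin order.length, CritA (F ∪ {c | c ∈ order.take i}) (order.get i)

end Combinatorics

end Summit.QuantumFields.YangMills.Cruxes.IR.CruxIdea2g4
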